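import Summits.CriticalPhenomena.PercolationContinuityZ3.Theorems.PercNearOneGluingNoHeavyLowerTailSahiSlotPairConeLifts
import Summits.CriticalPhenomena.PercolationContinuityZ3.Theorems.PercNearOneGluingNoHeavyLowerTailSahiSlotTensorConeOrderTwo
import Summits.CriticalPhenomena.PercolationContinuityZ3.Theorems.PercNearOneGluingNoHeavyLowerTailSahiSlotPairConeSlice

/-!
# FORMAT-LEVEL LIFTS of pinned (pivotal-pair) certificates: `PinnedGood n D → PinnedGood (n+1) (D × {1,2})` and `→ PinnedGood (n+1) (D × {2})`,
# every dimension; pinned certificates for all stacked orthants and the last-axis thresholds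

Support file of the one-cut programme (crux `NoHeavyLowerTail`, stmt-CriticalPhenomena-4575; cell `prim-masterthm`, seat P3, gen 23;
`run/shared/lean/prim/prim-masterthm/prim-masterthm-p3/HIERARCHY.md` §31, memo `FROM-prim-masterthm-p3-g23-FORMAT-LIFTS.md`).

CONTEXT.  The pivotal-pair conjecture (gens 21–22: `SahiSlot.PinnedLitCert d 2` for every `d` ⟹ Kahn / Sahi `C₃` for product measures) asks,
for every up-set `A ⊆ [3]^d`, for a `C ⊗ C` certificate of the bilinear functional `(B, C) ↦ sStarD A B C` (`SahiSlot.PinnedGood d A`,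
`…SahiSlotPairCone`).  Known in every dimension so far: `A = ⊤` (gen 22, the Harris slack) and `A = ∅`.  Gen 22 showed that the CYLINDER lift
`A ↦ A × [3]` admits no structure-preserving certificate recipe.  THIS FILE proves that the two OTHER pure lifts DO, with explicit recipes:
* `InCone.fibreHarris`: for an up-set `D ⊆ [3]^n`, a point `p` and a level `m`, the functional `C ↦ Σ_{q δ̸ p} 1_C(q,m)·(1_D(q) − 1_D(p̄q))`
  is in the single cone — the Boolean cube `[2]^n` embeds order-isomorphically onto the points totally distinct from `p` (`Emb`), its antipode
  becoming the third-point map, and gen 22's all-weights-one Harris-form certificate `harrisForm_eq_sum_coverPairs` applies (the `1_D`-increments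
  along parallel cube edges are the nonnegative coefficients, the `1_C`-increments are single-coordinate increments of `[3]^{n+1}`);
* every term of the exact remainders `remTwo`, `remTop` of `…SahiSlotPairConeLifts` is in the pair cone (`remTwo_inPairCone`, `remTop_inPairCone`);
* slice transport of certificates (`InCone.litSlice`, `InPairCone.slices`);
* **`PinnedGood.liftTwo`**, **`PinnedGood.liftTop`** — THE FORMAT-LEVEL LIFTS; value-level corollary `sStarD_liftTwo_nonneg` (prim-sahi-p1's lift, recovered);
* all-dimension instances: the last-axis thresholds `{x_last ≥ 1}`, `{x_last = 2}` (`pinnedGood_threshold_one/two`, every `n`) and every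
  STACKED ORTHANT `[3]^n × L₁ × ⋯ × L_k`, `L_i ∈ {{1,2},{2}}` (`pinnedGood_stackLift`) — the first all-`d` families of pinned certificates beyond `⊤`.
So the pivotal-pair format is closed under `× {2}` and `× {1,2}` in every dimension with INSTANCE-BLIND remainders, while (gen 22) it is not so closed
under `× [3]`: an inductive proof of the conjecture must treat the bottom layer differently (memo §3: per-instance LPs show the mixed chains
`(∅, D, E)` also lift through `d + 1 = 3`, cylinders do not).  HONEST LABEL: certificate-format theorems; no open cell changes status.
Pure, standard axioms. [this work]
-/

noncomputable section

namespace Summit.CriticalPhenomena.PercolationContinuityZ3.Theorems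

open Finset Function
open Literature.Combinatorics.Sahi2008

namespace SahiSlot

open SahiGridPattern SahiGrid3

variable {n : ℕ}

/-- Indicators of up-sets are monotone. [this work] -/
theorem ind_mono_upper {D : Finset (Pd n)} (hD : IsUpperSet (D : Set (Pd n))) {q q' : Pd n} (h : q ≤ q') : ind D q ≤ ind D q' := by
  unfold ind
  by_cases hq : q ∈ D
  · have hq' : q' ∈ D := hD h hq
    rw [if_pos hq, if_pos hq']
  · rw [if_neg hq]; split_ifs <;> norm_num

/-- Real indicator of a slice. [this work] -/
theorem setInd_sl (X : Finset (Pd (n + 1))) (j : Fin 3) (q : Pd n) : setInd (sl X j) q = setInd X (Fin.snoc q j) := by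
  rw [← cast_ind, ← ind_sl, cast_ind]

/-- Cast of a slice indicator. [this work] -/
theorem cast_ind_sl (X : Finset (Pd (n + 1))) (j : Fin 3) (q : Pd n) : ((ind (sl X j) q : ℤ) : ℝ) = setInd X (Fin.snoc q j) := by
  rw [cast_ind, setInd_sl]

/-! #### Vertical increments and points -/

/-- Vertical increments `C ↦ 1_C(q,k) − 1_C(q,j)`, `j ≤ k`, are in the cone. [this work] -/
theorem InCone.vincr (q : Pd n) {j k : Fin 3} (h : j ≤ k) :
    InCone (n + 1) (fun C => setInd C (Fin.snoc q k) - setInd C (Fin.snoc q j)) :=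
  (InCone.incr (Fin.snoc q 0 : Pd (n + 1)) (Fin.last n) h).congr fun C _ => by
    simp only [Fin.update_snoc_last]

/-! #### The Boolean cube of points totally distinct from `p`, and fibre Harris -/

/-- Increasing enumeration of `{0,1,2} ∖ {v}`. [this work] -/
def emb (v : Fin 3) (w : Fin 2) : Fin 3 := ![![1, 2], ![0, 2], ![0, 1]] v w

/-- Position of `w ≠ v` in `{0,1,2} ∖ {v}`. [this work] -/
def dmb (v w : Fin 3) : Fin 2 := ![![0, 0, 1], ![0, 0, 1], ![0, 1, 0]] v w

/-- `emb v w` avoids `v`. [this work] -/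
theorem emb_ne (v : Fin 3) (w : Fin 2) : emb v w ≠ v := by revert v w; unfold emb; decide
/-- `dmb` inverts `emb`. [this work] -/
theorem dmb_emb (v : Fin 3) (w : Fin 2) : dmb v (emb v w) = w := by revert v w; unfold emb dmb; decide
/-- `emb` inverts `dmb` off `v`. [this work] -/
theorem emb_dmb {v w : Fin 3} (h : w ≠ v) : emb v (dmb v w) = w := by revert v w; unfold emb dmb; decide
/-- `emb v` is increasing. [this work] -/
theorem emb_mono (v : Fin 3) : emb v 0 ≤ emb v 1 := by revert v; unfold emb; decide
/-- `emb v` intertwines reversal and the third-point formula. [this work] -/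
theorem emb_rev (v : Fin 3) (w : Fin 2) : emb v (Fin.rev w) = -(v + emb v w) := by revert v w; unfold emb; decide

/-- The order embedding of the Boolean cube `[2]^n` onto the points totally distinct from `p`. [this work] -/
def Emb (p : Pd n) (u : Q n 2) : Pd n := fun b => emb (p b) (u b)

/-- Its inverse on the image. [this work] -/
def Dmb (p q : Pd n) : Q n 2 := fun b => dmb (p b) (q b)

/-- `Emb p u` is totally distinct from `p`. [this work] -/
theorem totDist_Emb (p : Pd n) (u : Q n 2) : TotDist p (Emb p u) = true :=
  totDist_iff.2 fun b => (emb_ne (p b) (u b)).symm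

/-- `Dmb p` is a left inverse of `Emb p`. [this work] -/
theorem Dmb_Emb (p : Pd n) (u : Q n 2) : Dmb p (Emb p u) = u := funext fun b => dmb_emb (p b) (u b)

/-- `Emb p` recovers every point totally distinct from `p`. [this work] -/
theorem Emb_Dmb {p q : Pd n} (h : TotDist p q = true) : Emb p (Dmb p q) = q :=
  funext fun b => emb_dmb ((totDist_iff.1 h) b).symm

/-- The third point of `p` and `Emb p u` is `Emb p` of the antipode. [this work] -/
theorem thirdPt_Emb (p : Pd n) (u : Q n 2) : thirdPt p (Emb p u) = Emb p (antipode u) := by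
  funext b; unfold thirdPt Emb antipode; rw [emb_rev]

/-- `Emb p` of an updated point. [this work] -/
theorem Emb_update (p : Pd n) (u : Q n 2) (a : Fin n) (w : Fin 2) : Emb p (update u a w) = update (Emb p u) a (emb (p a) w) := by
  funext b; unfold Emb
  by_cases hb : b = a
  · subst hb; rw [update_self, update_self]
  · rw [update_of_ne hb, update_of_ne hb]

/-- Reindexing a sum over the points totally distinct from `p` by the Boolean cube. [this work] -/
theorem sum_totDist_eq_sum_Emb (p : Pd n) (F : Pd n → ℝ) :
    (∑ q, (if TotDist p q = true then (1:ℝ) else 0) * F q) = ∑ u : Q n 2, F (Emb p u) := by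
  have h1 : (∑ q, (if TotDist p q = true then (1:ℝ) else 0) * F q) = ∑ q ∈ univ.filter (fun q => TotDist p q = true), F q := by
    rw [Finset.sum_filter]
    exact Finset.sum_congr rfl fun q _ => by split_ifs <;> simp
  rw [h1]
  symm
  refine Finset.sum_nbij' (Emb p) (Dmb p) (fun u _ => ?_) (fun q _ => Finset.mem_univ _) (fun u _ => Dmb_Emb p u)
    (fun q hq => Emb_Dmb (Finset.mem_filter.1 hq).2) (fun u _ => rfl)
  exact Finset.mem_filter.2 ⟨Finset.mem_univ _, totDist_Emb p u⟩

/-- **Fibre Harris, FORMAT level**: for an up-set `D ⊆ [3]^n`, a point `p` and a level `m`, the functional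
`C ↦ Σ_{q δ̸ p} 1_C(q,m)·(1_D(q) − 1_D(p̄q))` on `[3]^{n+1}` is in the cone — by gen 22's Harris-form certificate
`harrisForm_eq_sum_coverPairs` on the Boolean cube of points totally distinct from `p` (whose antipode is the third-point map). [this work] -/
theorem InCone.fibreHarris {D : Finset (Pd n)} (hD : IsUpperSet (D : Set (Pd n))) (p : Pd n) (m : Fin 3) :
    InCone (n + 1) (fun C => ∑ q, (if TotDist p q = true then (1:ℝ) else 0) *
      (setInd C (Fin.snoc q m) * ((ind D q : ℝ) - ind D (thirdPt p q)))) := by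
  obtain ⟨ι, hι, ω, ω', a, hω, hω', hid⟩ := harrisForm_eq_sum_coverPairs n
  -- the certificate terms
  have hterm : ∀ t : ι, InCone (n + 1) (fun C => setInd C (Fin.snoc (Emb p (update (ω t) (a t) 1)) m) - setInd C (Fin.snoc (Emb p (ω t)) m)) := by
    intro t
    have e0 : Emb p (ω t) = update (Emb p (ω t)) (a t) (emb (p (a t)) 0) := by
      conv_lhs => rw [← update_eq_self (a t) (ω t), hω t]
      rw [Emb_update]
    have e1 : update (Fin.snoc (Emb p (ω t)) m : Pd (n + 1)) (Fin.castSucc (a t)) (emb (p (a t)) 0) = Fin.snoc (Emb p (ω t)) m := by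
      rw [← Fin.snoc_update, ← e0]
    refine (InCone.incr (Fin.snoc (Emb p (ω t)) m : Pd (n + 1)) (Fin.castSucc (a t)) (emb_mono (p (a t)))).congr fun C _ => ?_
    rw [Emb_update, Fin.snoc_update, e1]
  have hcoef : ∀ t : ι, (0:ℝ) ≤ (ind D (Emb p (update (ω' t) (a t) 1)) : ℝ) - ind D (Emb p (ω' t)) := by
    intro t
    have hle : Emb p (ω' t) ≤ Emb p (update (ω' t) (a t) 1) := by
      intro b; unfold Emb
      by_cases hb : b = a t
      · rw [hb, update_self, hω' t]; exact emb_mono _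
      · rw [update_of_ne hb]
    have := ind_mono_upper hD hle
    exact_mod_cast sub_nonneg.2 this
  refine (InCone.sum_smul univ (fun t _ => hcoef t) fun t _ => hterm t).congr fun C _ => ?_
  rw [sum_totDist_eq_sum_Emb p]
  have e2 : (∑ u : Q n 2, setInd C (Fin.snoc (Emb p u) m) * ((ind D (Emb p u) : ℝ) - ind D (thirdPt p (Emb p u)))) =
      ∑ u : Q n 2, (fun u => setInd C (Fin.snoc (Emb p u) m)) u *
        ((fun u => (ind D (Emb p u) : ℝ)) u - (fun u => (ind D (Emb p u) : ℝ)) (antipode u)) :=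
    Finset.sum_congr rfl fun u _ => by rw [thirdPt_Emb]
  rw [e2, hid]
  exact Finset.sum_congr rfl fun t _ => by ring

/-! #### The six kinds of remainder terms -/

/-- Fibre-Kleitman term with the `B`-increment as free argument:
`Σ_{p δ̸ q} (1_B(p,k) − 1_B(p,j))·1_C(q,m)·(1_D(q) − 1_D(p̄q))` is in the pair cone. [this work] -/
theorem inPairCone_Kb {D : Finset (Pd n)} (hD : IsUpperSet (D : Set (Pd n))) {j k : Fin 3} (hjk : j ≤ k) (m : Fin 3) :
    InPairCone (n + 1) (fun B C => ((Nf (ind (sl B k) - ind (sl B j)) (ind D) (ind (sl C m))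
      - Lf (ind D) (ind (sl B k) - ind (sl B j)) (ind (sl C m)) : ℤ) : ℝ)) := by
  refine (InPairCone.sum univ fun p _ => InPairCone.mul (InCone.vincr p hjk) (InCone.fibreHarris hD p m)).congr fun B C _ _ => ?_
  unfold Nf Lf
  rw [← Finset.sum_sub_distrib]
  push_cast
  refine Finset.sum_congr rfl fun p _ => ?_
  rw [← Finset.sum_sub_distrib, Finset.mul_sum]
  refine Finset.sum_congr rfl fun q _ => ?_
  simp only [Pi.sub_apply, Int.cast_sub, cast_ind_sl]
  ring

/-- Fibre-Kleitman term with the `C`-increment as free argument. [this work] -/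
theorem inPairCone_Kc {D : Finset (Pd n)} (hD : IsUpperSet (D : Set (Pd n))) {j k : Fin 3} (hjk : j ≤ k) (m : Fin 3) :
    InPairCone (n + 1) (fun B C => ((Nf (ind (sl C k) - ind (sl C j)) (ind D) (ind (sl B m))
      - Lf (ind D) (ind (sl B m)) (ind (sl C k) - ind (sl C j)) : ℤ) : ℝ)) := by
  refine (InPairCone.sum univ fun p _ => InPairCone.mul (InCone.fibreHarris hD p m) (InCone.vincr p hjk)).congr fun B C _ _ => ?_
  unfold Nf Lf
  rw [Finset.sum_comm (f := fun q r => (ind (sl B m)) q * (ind (sl C k) - ind (sl C j)) r * (ind D) (thirdPt q r) *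
    (if TotDist q r = true then (1:ℤ) else 0)), ← Finset.sum_sub_distrib]
  push_cast
  refine Finset.sum_congr rfl fun p _ => ?_
  rw [← Finset.sum_sub_distrib, Finset.sum_mul]
  refine Finset.sum_congr rfl fun q _ => ?_
  simp only [Pi.sub_apply, Int.cast_sub, cast_ind_sl, thirdPt_comm q p, totDist_symm q p]
  ring

/-- Point × vertical-increment term `Σ_{p δ̸ q} 1_D(p)·1_B(q,m)·(1_C(q,k) − 1_C(q,j))`. [this work] -/
theorem inPairCone_PV (D : Finset (Pd n)) (m : Fin 3) {j k : Fin 3} (hjk : j ≤ k) :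
    InPairCone (n + 1) (fun B C => ((Nf (ind D) (ind (sl B m)) (ind (sl C k) - ind (sl C j)) : ℤ) : ℝ)) := by
  have hw : ∀ x ∈ (univ : Finset (Pd n × Pd n)), (0:ℝ) ≤ (ind D x.1 : ℝ) * (if TotDist x.1 x.2 = true then (1:ℝ) else 0) :=
    fun x _ => mul_nonneg (by exact_mod_cast ind_nonneg' D x.1) (by split_ifs <;> norm_num)
  refine (InPairCone.sum_smul univ hw fun x _ => InPairCone.mul (InCone.point (Fin.snoc x.2 m : Pd (n + 1))) (InCone.vincr x.2 hjk)).congr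
    fun B C _ _ => ?_
  unfold Nf
  push_cast
  rw [← Finset.univ_product_univ, Finset.sum_product]
  refine Finset.sum_congr rfl fun p _ => Finset.sum_congr rfl fun q _ => ?_
  simp only [Pi.sub_apply, Int.cast_sub, cast_ind_sl]
  ring

/-- Vertical-increment × point term `Σ_{p δ̸ q} 1_D(p)·(1_B(q,k) − 1_B(q,j))·1_C(q,m)`. [this work] -/
theorem inPairCone_VP (D : Finset (Pd n)) {j k : Fin 3} (hjk : j ≤ k) (m : Fin 3) :
    InPairCone (n + 1) (fun B C => ((Nf (ind D) (ind (sl B k) - ind (sl B j)) (ind (sl C m)) : ℤ) : ℝ)) := by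
  have hw : ∀ x ∈ (univ : Finset (Pd n × Pd n)), (0:ℝ) ≤ (ind D x.1 : ℝ) * (if TotDist x.1 x.2 = true then (1:ℝ) else 0) :=
    fun x _ => mul_nonneg (by exact_mod_cast ind_nonneg' D x.1) (by split_ifs <;> norm_num)
  refine (InPairCone.sum_smul univ hw fun x _ => InPairCone.mul (InCone.vincr x.2 hjk) (InCone.point (Fin.snoc x.2 m : Pd (n + 1)))).congr
    fun B C _ _ => ?_
  unfold Nf
  push_cast
  rw [← Finset.univ_product_univ, Finset.sum_product]
  refine Finset.sum_congr rfl fun p _ => Finset.sum_congr rfl fun q _ => ?_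
  simp only [Pi.sub_apply, Int.cast_sub, cast_ind_sl]
  ring

/-- Diagonal increment × increment term `Σ_p 1_D(p)·(1_B(p,k) − 1_B(p,j))·(1_C(p,k') − 1_C(p,j'))`. [this work] -/
theorem inPairCone_Dg (D : Finset (Pd n)) {j k j' k' : Fin 3} (hjk : j ≤ k) (hjk' : j' ≤ k') :
    InPairCone (n + 1) (fun B C => ((Dg (ind D) (ind (sl B k) - ind (sl B j)) (ind (sl C k') - ind (sl C j')) : ℤ) : ℝ)) := by
  have hw : ∀ p ∈ (univ : Finset (Pd n)), (0:ℝ) ≤ (ind D p : ℝ) := fun p _ => by exact_mod_cast ind_nonneg' D p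
  refine (InPairCone.sum_smul univ hw fun p _ => InPairCone.mul (InCone.vincr p hjk) (InCone.vincr p hjk')).congr fun B C _ _ => ?_
  unfold Dg
  push_cast
  refine Finset.sum_congr rfl fun p _ => ?_
  simp only [Pi.sub_apply, Int.cast_sub, cast_ind_sl]
  ring

/-- Opposite increment × increment term, `C`-increment at the free point: `Σ_{p δ̸ q} (1_C(p,k') − 1_C(p,j'))·1_D(q)·(1_B(q,k) − 1_B(q,j))`. [this work] -/
theorem inPairCone_VVc (D : Finset (Pd n)) {j k j' k' : Fin 3} (hjk : j ≤ k) (hjk' : j' ≤ k') :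
    InPairCone (n + 1) (fun B C => ((Nf (ind (sl C k') - ind (sl C j')) (ind D) (ind (sl B k) - ind (sl B j)) : ℤ) : ℝ)) := by
  have hw : ∀ x ∈ (univ : Finset (Pd n × Pd n)), (0:ℝ) ≤ (ind D x.2 : ℝ) * (if TotDist x.1 x.2 = true then (1:ℝ) else 0) :=
    fun x _ => mul_nonneg (by exact_mod_cast ind_nonneg' D x.2) (by split_ifs <;> norm_num)
  refine (InPairCone.sum_smul univ hw fun x _ => InPairCone.mul (InCone.vincr x.2 hjk) (InCone.vincr x.1 hjk')).congr fun B C _ _ => ?_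
  unfold Nf
  push_cast
  rw [← Finset.univ_product_univ, Finset.sum_product]
  refine Finset.sum_congr rfl fun p _ => Finset.sum_congr rfl fun q _ => ?_
  simp only [Pi.sub_apply, Int.cast_sub, cast_ind_sl]
  ring

/-- Opposite increment × increment term, `B`-increment at the free point: `Σ_{p δ̸ q} (1_B(p,k) − 1_B(p,j))·1_D(q)·(1_C(q,k') − 1_C(q,j'))`. [this work] -/
theorem inPairCone_VVb (D : Finset (Pd n)) {j k j' k' : Fin 3} (hjk : j ≤ k) (hjk' : j' ≤ k') :
    InPairCone (n + 1) (fun B C => ((Nf (ind (sl B k) - ind (sl B j)) (ind D) (ind (sl C k') - ind (sl C j')) : ℤ) : ℝ)) := by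
  have hw : ∀ x ∈ (univ : Finset (Pd n × Pd n)), (0:ℝ) ≤ (ind D x.2 : ℝ) * (if TotDist x.1 x.2 = true then (1:ℝ) else 0) :=
    fun x _ => mul_nonneg (by exact_mod_cast ind_nonneg' D x.2) (by split_ifs <;> norm_num)
  refine (InPairCone.sum_smul univ hw fun x _ => InPairCone.mul (InCone.vincr x.1 hjk) (InCone.vincr x.2 hjk')).congr fun B C _ _ => ?_
  unfold Nf
  push_cast
  rw [← Finset.univ_product_univ, Finset.sum_product]
  refine Finset.sum_congr rfl fun p _ => Finset.sum_congr rfl fun q _ => ?_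
  simp only [Pi.sub_apply, Int.cast_sub, cast_ind_sl]
  ring

/-- **The two-level remainder is in the pair cone** (for an up-set `D`). [this work] -/
theorem remTwo_inPairCone {D : Finset (Pd n)} (hD : IsUpperSet (D : Set (Pd n))) :
    InPairCone (n + 1) (fun B C => (remTwo D B C : ℝ)) := by
  have h01 : (0:Fin 3) ≤ 1 := by decide
  have h02 : (0:Fin 3) ≤ 2 := by decide
  have h12 : (1:Fin 3) ≤ 2 := by decide
  have h2n : (0:ℝ) ≤ 2 * 2 ^ n := by positivity
  refine ((((((((((inPairCone_Kb hD h01 1).add (inPairCone_Kb hD h02 2)).add (inPairCone_Kc hD h01 2)).add (inPairCone_Kc hD h02 1)).add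
    (inPairCone_PV D 0 h01)).add (inPairCone_PV D 0 h02)).add (inPairCone_VP D h02 1)).add (inPairCone_VP D h01 2)).add
    ((inPairCone_Dg D h12 h12).smul h2n)).add (inPairCone_VVc D h12 h12)).congr fun B C _ _ => ?_
  unfold remTwo
  push_cast
  ring

/-- **The top-only remainder is in the pair cone** (for an up-set `E`). [this work] -/
theorem remTop_inPairCone {E : Finset (Pd n)} (hE : IsUpperSet (E : Set (Pd n))) :
    InPairCone (n + 1) (fun B C => (remTop E B C : ℝ)) := by
  have h01 : (0:Fin 3) ≤ 1 := by decide
  have h02 : (0:Fin 3) ≤ 2 := by decide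
  have h12 : (1:Fin 3) ≤ 2 := by decide
  refine ((((((((((inPairCone_Kb hE h02 1).add (inPairCone_Kb hE h12 0)).add (inPairCone_Kc hE h02 2)).add (inPairCone_Kc hE h12 2)).add
    (inPairCone_PV E 0 h02)).add (inPairCone_PV E 1 h12)).add (inPairCone_VP E h02 2)).add (inPairCone_VP E h12 2)).add
    (inPairCone_VVb E h02 h12)).add (inPairCone_VVb E h12 h02)).congr fun B C _ _ => ?_
  unfold remTop
  push_cast
  ring

/-! ### Slice transport of certificates, and THE LIFT THEOREMS -/

/-- The constant-`2` point of `[3]^{n+1}` is the `snoc` of the constant-`2` point. [this work] -/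
theorem top_eq_snoc : (fun _ : Fin (n + 1) => (2 : Fin 3)) = Fin.snoc (fun _ : Fin n => (2 : Fin 3)) 2 := by
  funext i; refine Fin.lastCases ?_ (fun j => ?_) i
  · rw [Fin.snoc_last]
  · rw [Fin.snoc_castSucc]

/-- A literal of `[3]^n` evaluated on the level-`j` slice is a cone functional on `[3]^{n+1}`. [this work] -/
theorem InCone.litSlice (ℓ : Lit n 3) (j : Fin 3) : InCone (n + 1) (fun B => ℓ.eval (setInd (sl B j))) := by
  cases ℓ with
  | bot =>
    refine (InCone.point (Fin.snoc (fun _ : Fin n => (0 : Fin 3)) j : Pd (n + 1))).congr fun B _ => ?_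
    rw [eval_bot_setInd, setInd_sl]
  | top =>
    have h1 : InCone (n + 1) (fun B => (Lit.top : Lit (n + 1) 3).eval (setInd B)) := InCone.lit _
    have hj2 : j ≤ (2 : Fin 3) := Fin.le_last j
    have h2 := InCone.vincr (n := n) (fun _ => (2 : Fin 3)) hj2
    refine (h1.add h2).congr fun B _ => ?_
    rw [eval_top_setInd, eval_top_setInd, setInd_sl, top_eq_snoc]
    ring
  | cover p a =>
    by_cases h : (p a : ℕ) + 1 < 3
    · have hle : p a ≤ (⟨(p a : ℕ) + 1, h⟩ : Fin 3) := Fin.le_iff_val_le_val.2 (Nat.le_succ _)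
      refine (InCone.incr (Fin.snoc p j : Pd (n + 1)) (Fin.castSucc a) hle).congr fun B _ => ?_
      rw [eval_cover_setInd _ p a h, setInd_sl, setInd_sl, Fin.snoc_update]
      congr 2
      conv_lhs => rw [← update_eq_self (Fin.castSucc a) (Fin.snoc p j : Pd (n + 1)), Fin.snoc_castSucc]
    · refine InCone.zero.congr fun B _ => ?_
      show (if h' : (p a : ℕ) + 1 < 3 then setInd (sl B j) (update p a ⟨(p a : ℕ) + 1, h'⟩) - setInd (sl B j) p else 0) = 0
      rw [dif_neg h]

/-- **Slice transport**: a pair-cone functional of the slices is a pair-cone functional. [this work] -/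
theorem InPairCone.slices {F : Finset (Pd n) → Finset (Pd n) → ℝ} (hF : InPairCone n F) (j k : Fin 3) :
    InPairCone (n + 1) (fun B C => F (sl B j) (sl C k)) := by
  obtain ⟨ι, hι, c, J, J', hc, hid⟩ := hF
  refine (InPairCone.sum_smul univ (fun i _ => hc i) fun i _ => InPairCone.mul (InCone.litSlice (J i) j) (InCone.litSlice (J' i) k)).congr
    fun B C hB hC => ?_
  exact hid (sl B j) (sl C k) (isUpperSet_sl hB j) (isUpperSet_sl hC k)

/-- **THE TWO-LEVEL LIFT at the format level**: if the up-set `D ⊆ [3]^n` has a pinned (pivotal-pair) certificate, so does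
`D × {1,2} ⊆ [3]^{n+1}` — explicitly: the four slice certificates plus the ten-term remainder. [this work] -/
theorem PinnedGood.liftTwo {D : Finset (Pd n)} (hD : IsUpperSet (D : Set (Pd n))) (h : PinnedGood n D) :
    PinnedGood (n + 1) (liftTwo D) := by
  refine (((((h.slices 1 1).add (h.slices 1 2)).add (h.slices 2 1)).add (h.slices 2 2)).add (remTwo_inPairCone hD)).congr
    fun B C _ _ => ?_
  rw [sStarD_liftTwo_eq]; push_cast; ring

/-- **THE TOP-ONLY LIFT at the format level**: if the up-set `E ⊆ [3]^n` has a pinned certificate, so does `E × {2} ⊆ [3]^{n+1}`. [this work] -/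
theorem PinnedGood.liftTop {E : Finset (Pd n)} (hE : IsUpperSet (E : Set (Pd n))) (h : PinnedGood n E) :
    PinnedGood (n + 1) (liftTop E) := by
  refine (((h.slices 2 2).smul (by norm_num : (0:ℝ) ≤ 2)).add (remTop_inPairCone hE)).congr fun B C _ _ => ?_
  rw [sStarD_liftTop_eq]; push_cast; ring

/-- VALUE-LEVEL corollaries (prim-sahi-p1's instance-blind lifts, recovered): the lifted sets are good first slots. [this work] -/
theorem sStarD_liftTwo_nonneg {D : Finset (Pd n)} (hD : IsUpperSet (D : Set (Pd n))) (h : PinnedGood n D) (B C : Finset (Pd (n + 1)))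
    (hB : IsUpperSet (B : Set (Pd (n + 1)))) (hC : IsUpperSet (C : Set (Pd (n + 1)))) : 0 ≤ sStarD (liftTwo D) B C :=
  (h.liftTwo hD).sStarD_nonneg B C hB hC

/-! ### All-dimension instances: coordinate thresholds in the last axis, and iterated lifts of `⊤` -/

/-- The threshold slot `{x : x_last ≥ 1} ⊆ [3]^{n+1}` has a pinned certificate, every `n`. [this work] -/
theorem pinnedGood_threshold_one (n : ℕ) : PinnedGood (n + 1) (liftTwo (univ : Finset (Pd n))) :=
  (pinnedGood_univ n).liftTwo (by rw [Finset.coe_univ]; exact isUpperSet_univ)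

/-- The threshold slot `{x : x_last = 2} ⊆ [3]^{n+1}` has a pinned certificate, every `n`. [this work] -/
theorem pinnedGood_threshold_two (n : ℕ) : PinnedGood (n + 1) (liftTop (univ : Finset (Pd n))) :=
  (pinnedGood_univ n).liftTop (by rw [Finset.coe_univ]; exact isUpperSet_univ)

/-- Iterated lifts of `⊤`: the orthant `[3]^n × L₁ × ⋯ × L_k` with each `L_i ∈ {{1,2},{2}}` (encoded by `ls : List Bool`, `true ↦ {2}`),
i.e. every principal up-set `↑p` whose zero coordinates come first, has a pinned certificate in every dimension. [this work] -/
def stackLift (n : ℕ) : (ls : List Bool) → Finset (Pd (n + ls.length))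
  | [] => univ
  | true :: ls => liftTop (stackLift n ls)
  | false :: ls => liftTwo (stackLift n ls)

/-- Stacked orthants are up-sets. [this work] -/
theorem isUpperSet_stackLift (n : ℕ) : ∀ ls : List Bool, IsUpperSet ((stackLift n ls : Finset (Pd (n + ls.length))) : Set (Pd (n + ls.length)))
  | [] => by rw [show stackLift n [] = univ from rfl, Finset.coe_univ]; exact isUpperSet_univ
  | true :: ls => by
    rw [show stackLift n (true :: ls) = liftTop (stackLift n ls) from rfl]
    exact isUpperSet_liftTop (isUpperSet_stackLift n ls)
  | false :: ls => by
    rw [show stackLift n (false :: ls) = liftTwo (stackLift n ls) from rfl]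
    exact isUpperSet_liftTwo (isUpperSet_stackLift n ls)

/-- **Every stacked orthant has a pinned certificate** (all `n`, all level lists). [this work] -/
theorem pinnedGood_stackLift (n : ℕ) : ∀ ls : List Bool, PinnedGood (n + ls.length) (stackLift n ls)
  | [] => by rw [show stackLift n [] = univ from rfl]; exact pinnedGood_univ n
  | true :: ls => by
    rw [show stackLift n (true :: ls) = liftTop (stackLift n ls) from rfl]
    exact (pinnedGood_stackLift n ls).liftTop (isUpperSet_stackLift n ls)
  | false :: ls => by
    rw [show stackLift n (false :: ls) = liftTwo (stackLift n ls) from rfl]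
    exact (pinnedGood_stackLift n ls).liftTwo (isUpperSet_stackLift n ls)

end SahiSlot

end Summit.CriticalPhenomena.PercolationContinuityZ3.Theorems
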